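import Literature.IUT.HodgeArakelov.StableCurveAgreementOfCoverModel
import HarnessLib

/-!
# [IUTchII] Def 2.3 (ii) / Rmk 2.3.1 at the genuine tower: the PROFINITE cuspidal datum of `Π̂^±_v` (closures of the cusp family) and
# GAP-LEDGER G-w5d243-1's law (a) «cuspidal inertia groups of `Π̂^±_v` are permuted by `Π̂^cor_v`-conjugation» — PROVED there

S. Mochizuki, *Inter-universal Teichmüller Theory II*, kurims manuscript (Dec. 2020), §2, Def 2.3 (i)(ii) pp. 67–68 («`Π̂^±_v := Π̂_{X_v}`»;
the cuspidal inertia groups of the profinite `Π̂^±_v`), Rmk 2.3.1 p. 69 and Def 2.3 (v) p. 69 («the natural action of `Π_⊇/Π_⊆` on `Π_⊆`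
preserves this `𝔽^±_l`-torsor structure»: cuspidal inertia groups of the NORMAL subgroup `Π̂^±_v ⊴ Π̂^cor_v` are permuted by
`Π̂^cor_v`-conjugation) [cite: Mochizuki2012, II Def 2.3 (i)(ii)(v) pp.67–69; I §2 p.46] [cite: MochizukiSemiAnbd2006, §6 pp.69,71].
abc-iut cell, MERGE-MAP B13/B14 (lineage row «B13-GENUINE», seat abc-iut-w5-d132 gen 4); the tempered-level datum is p430433
(`exists_stableCurveAgreement_ofCoverModel`, cusp family `I (x, g) := ι((g · inclX(I_x) · g⁻¹) ∩ inclX(Π^tp_{X̲_v}))`, `g ∈ Π^tp_C`).  Here: the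
PROFINITE-level datum print actually speaks of at `Π̂^±_v` — the `Π̂^±_v`-conjugates of the CLOSURES `cl I (x, g)` in `Π̂^cor_v = Q` —
and the law GAP-LEDGER **G-w5d243-1 (a)** asks of `CuspidalInertiaData` («`conj_stable : ∀ (g : Π̂^cor_v) I, IsCuspidalInertia Π̂^±_v I →
IsCuspidalInertia Π̂^±_v (g I g⁻¹)`»), PROVED for it at abc-iut-L6-t19's genuine tower `ofCoverModel` / `ofPiCHat` (p430122):

* `cor_sup_pmHat_eq_top` — `ι(Π^tp_C) · Π̂^±_v = Π̂^cor_v` (`Π̂^±_v` is closed of finite index `2l`, hence open; `ι(Π^tp_C)` is dense);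
* `conj_smul_topologicalClosure` — conjugation commutes with closure (a homeomorphism);
* **`exists_cuspidalInertiaDataHat_ofCoverModel`** — there is `CuHat : CuspidalInertiaData (ofCoverModel …)` with, at every level `Π_□`,
  «`J` cuspidal» ⟺ «`J ⊆ Π_□` and `J = γ · cl I (x, g) · γ⁻¹` for a cusp `x` of `X`, `g ∈ Π^tp_C`, `γ ∈ Π̂^±_v`», and satisfying LAW (a):
  for EVERY `g' ∈ Π̂^cor_v`, `Π̂^±_v`-cuspidal ⇒ `g'`-conjugate `Π̂^±_v`-cuspidal — because `g' = ι(c) · π` (`c ∈ Π^tp_C`, `π ∈ Π̂^±_v`) and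
  `ι(c) · cl I (x, g) · ι(c)⁻¹ = cl I (x, c g)` (`Π^tp_{X̲_v} ⊴ Π^tp_C`, p430433 `conj_ι_smul_cuspFamily`); `_ofPiCHat` = the tower of record.

HONEST LABEL: a THEOREM about the kernel's genuine tower (mod its printed inputs `hZ`, `hN` and the parameters `ι`, `Φ`); it shows law (a) is
TRUE at the genuine instance for the natural profinite datum — it does not repair abc-iut-L6-t1's interface (that is the row's business) and
asserts nothing of the series.  PROOF-ONLY (no `def`).  No side taken on [IUTchIII] Cor 3.12.
-/

noncomputable section

namespace Literature.IUT.HodgeArakelov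

open Literature.AnabelianGeometry.EtaleTheta Literature.AnabelianGeometry.SemiGraphs
open scoped Pointwise

/-- Conjugation commutes with topological closure of subgroups (conjugation is a homeomorphism of the group). [folklore] -/
private theorem conj_smul_topologicalClosure {G : Type} [Group G] [TopologicalSpace G] [IsTopologicalGroup G]
    (a : G) (H : Subgroup G) : MulAut.conj a • H.topologicalClosure = (MulAut.conj a • H).topologicalClosure := by
  apply SetLike.coe_injective
  rw [Subgroup.coe_pointwise_smul, Subgroup.topologicalClosure_coe, Subgroup.topologicalClosure_coe,
    Subgroup.coe_pointwise_smul]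
  -- `a • closure H = closure (a • H)` for the homeomorphism `x ↦ a x a⁻¹`
  let h : G ≃ₜ G := (Homeomorph.mulLeft a).trans (Homeomorph.mulRight a⁻¹)
  have hh : ∀ s : Set G, MulAut.conj a • s = h '' s := by
    intro s
    ext y
    simp only [Set.mem_smul_set, Set.mem_image, MulAut.smul_def, MulAut.conj_apply]
    constructor
    · rintro ⟨x, hx, rfl⟩; exact ⟨x, hx, rfl⟩
    · rintro ⟨x, hx, rfl⟩; exact ⟨x, hx, rfl⟩
  rw [hh, hh, h.image_closure]

namespace PlusMinusTower

variable {p : ℕ} [Fact p.Prime] {M : MuTwoSetting p} (e : M.CLevelData)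
  {E : M.toThetaSetting.EtaleThetaData} {l : ℕ} (C : E.DoubleUnderline l) {N : ℕ+}
  (μ : M.toThetaSetting.CyclotomeMod l N) (hC : M.toThetaSetting.Compat) (hS : M.toThetaSetting.Sec2Hyps)
  (hl : l.Prime) (hp2 : p ≠ 2) (hpl : p ≠ l) (hζ : ∃ ζ : M.toThetaSetting.K, IsPrimitiveRoot ζ (4 * l))
  {η : (C.thetaEnvData μ hC hS).PiYdd → MuN p N} (hη : η ∈ (C.thetaEnvData μ hC hS).thetaCocycles)
  {Q : Type} [Group Q] [TopologicalSpace Q] [IsTopologicalGroup Q]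
  (ι : M.GtpC →ₜ* Q) (hι : IsProfiniteCompletion ι) (hinj : Function.Injective ι)
  (Φ : Q →* GQp p) (hΦ : ∀ g : M.GtpC, Φ (ι g) = e.augC g) (hΦK : Φ.range = M.GK)
  (hZ : Thm16Sub.KerToZIsCompactlyGenerated M.toThetaSetting) (hN : (C.Huu.subgroupOf (M.GtpXu l)).Normal)
  {P : TopGroup.{0}} (T : TemperedCoverings (BadPlaceSetting.ofUnderline C μ hC hS hl hp2 hpl hζ hη) P)

/-- **`Π^cor_v · Π̂^±_v = Π̂^cor_v`** at the genuine tower: `ι(Π^tp_C) ⊔ cl ι(inclX Π^tp_{X̲_v}) = ⊤` — the closed subgroup `Π̂^±_v` has finite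
index `2l` (abc-iut-L6-t19 `ofCoverModel_indices`), hence is open, so `ι(Π^tp_C) · Π̂^±_v` is an open (hence closed) subgroup containing the
dense `ι(Π^tp_C)`.  ([IUTchII] Def 2.3 (i), kurims p.67) [claim: Mochizuki2012, status: disputed] -/
theorem cor_sup_pmHat_eq_top :
    (ofCoverModel e C μ hC hS hl hp2 hpl hζ hη ι hι hinj Φ hΦ hΦK hZ hN T).cor ⊔
      (ofCoverModel e C μ hC hS hl hp2 hpl hζ hη ι hι hinj Φ hΦ hΦK hZ hN T).pmHat = ⊤ := by
  haveI := hι.compactSpace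
  -- work in `Q`
  change ι.toMonoidHom.range ⊔ (((M.GtpXu l).map M.inclX).map ι.toMonoidHom).topologicalClosure = (⊤ : Subgroup Q)
  set XU : Subgroup Q := (((M.GtpXu l).map M.inclX).map ι.toMonoidHom).topologicalClosure with hXU
  have hfin : XU.FiniteIndex := ⟨by
    have h := (ofCoverModel_indices e C μ hC hS hl hp2 hpl hζ hη ι hι hinj Φ hΦ hΦK hZ hN T).1
    change XU.index = 2 * l at h
    rw [h]; exact mul_ne_zero two_ne_zero C.l_ne_zero⟩
  have hopen : IsOpen (XU : Set Q) :=
    Subgroup.isOpen_of_isClosed_of_finiteIndex XU (Subgroup.isClosed_topologicalClosure _)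
  have hSopen : IsOpen ((ι.toMonoidHom.range ⊔ XU : Subgroup Q) : Set Q) :=
    Subgroup.isOpen_mono le_sup_right hopen
  have hSclosed : IsClosed ((ι.toMonoidHom.range ⊔ XU : Subgroup Q) : Set Q) := Subgroup.isClosed_of_isOpen _ hSopen
  rw [eq_top_iff]
  intro q _
  have hdense : Dense ((ι.toMonoidHom.range : Subgroup Q) : Set Q) := by
    rw [MonoidHom.coe_range]
    exact hι.denseRange
  have : q ∈ closure ((ι.toMonoidHom.range : Subgroup Q) : Set Q) := by rw [hdense.closure_eq]; trivial
  exact hSclosed.closure_subset_iff.mpr (fun x hx => Subgroup.mem_sup_left hx) this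

include hZ e in
omit [TopologicalSpace Q] [IsTopologicalGroup Q] in
/-- `ι(c) · I (x, g) · ι(c)⁻¹ = I (x, c g)` for the cusp family (p430433 `conj_ι_smul_cuspFamily` with `h = 1`). ([IUTchII] Rmk 2.3.1, kurims p.69)
[claim: Mochizuki2012, status: disputed] -/
theorem conj_ι_smul_cuspFamily_one {Q : Type} [Group Q] (ι : M.GtpC →* Q) (c g : M.GtpC) (Ix : Subgroup M.GtpC) :
    MulAut.conj (ι c) • (((MulAut.conj g • Ix) ⊓ (M.GtpXu l).map M.inclX).map ι) =
      ((MulAut.conj (c * g) • Ix) ⊓ (M.GtpXu l).map M.inclX).map ι := by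
  have h := conj_ι_smul_cuspFamily (l := l) e hZ ι c 1 g Ix
  try simp only [mul_one] at h
  exact h

/-- **The PROFINITE cuspidal datum of the genuine tower and G-w5d243-1's law (a).**  There is `CuHat : CuspidalInertiaData (ofCoverModel …)` whose
cuspidal inertia groups at every level `Π_□` are «`J ⊆ Π_□` with `J = γ · cl I (x, g) · γ⁻¹`, `x` a cusp of `X`, `g ∈ Π^tp_C`, `γ ∈ Π̂^±_v`» — the
`Π̂^±_v`-conjugates of the closures of the cusp family, i.e. print's cuspidal inertia groups of the profinite `Π̂^±_v = Π̂_{X̲_v}` (Def 2.3 (ii))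
— and which satisfies LAW (a) of GAP-LEDGER G-w5d243-1: for EVERY `g' ∈ Π̂^cor_v`, a `Π̂^±_v`-cuspidal group conjugated by `g'` is again
`Π̂^±_v`-cuspidal (Rmk 2.3.1; `g' = ι(c)·π` by `cor_sup_pmHat_eq_top`, `ι(c)·cl I(x,g)·ι(c)⁻¹ = cl I(x, c g)`, `Π̂^±_v ⊴ Π̂^cor_v`).  PROVED.
([IUTchII] Def 2.3 (ii)(v), Rmk 2.3.1, kurims pp.68–69) [claim: Mochizuki2012, status: disputed] -/
theorem exists_cuspidalInertiaDataHat_ofCoverModel :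
    ∃ CuHat : CuspidalInertiaData (ofCoverModel e C μ hC hS hl hp2 hpl hζ hη ι hι hinj Φ hΦ hΦK hZ hN T),
      (∀ Q' J : Subgroup (ofCoverModel e C μ hC hS hl hp2 hpl hζ hη ι hι hinj Φ hΦ hΦK hZ hN T).Corhat,
        CuHat.IsCuspidalInertia Q' J ↔ J ≤ Q' ∧ ∃ i : {x : M.Pt // M.IsCusp x} × M.GtpC,
          ∃ γ ∈ (ofCoverModel e C μ hC hS hl hp2 hpl hζ hη ι hι hinj Φ hΦ hΦK hZ hN T).pmHat,
            J = MulAut.conj γ •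
              ((((MulAut.conj i.2 • (M.toTemperedCurve.inertia i.1.1).map M.inclX) ⊓ (M.GtpXu l).map M.inclX).map
                ι.toMonoidHom : Subgroup (ofCoverModel e C μ hC hS hl hp2 hpl hζ hη ι hι hinj Φ hΦ hΦK hZ hN T).Corhat)).topologicalClosure) ∧
      (∀ (g' : (ofCoverModel e C μ hC hS hl hp2 hpl hζ hη ι hι hinj Φ hΦ hΦK hZ hN T).Corhat)
          (J : Subgroup (ofCoverModel e C μ hC hS hl hp2 hpl hζ hη ι hι hinj Φ hΦ hΦK hZ hN T).Corhat),
        CuHat.IsCuspidalInertia (ofCoverModel e C μ hC hS hl hp2 hpl hζ hη ι hι hinj Φ hΦ hΦK hZ hN T).pmHat J →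
          CuHat.IsCuspidalInertia (ofCoverModel e C μ hC hS hl hp2 hpl hζ hη ι hι hinj Φ hΦ hΦK hZ hN T).pmHat
            (MulAut.conj g' • J)) := by
  -- abbreviations (in `Q`)
  let W := ofCoverModel e C μ hC hS hl hp2 hpl hζ hη ι hι hinj Φ hΦ hΦK hZ hN T
  let fam : {x : M.Pt // M.IsCusp x} × M.GtpC → Subgroup W.Corhat := fun i =>
    ((((MulAut.conj i.2 • (M.toTemperedCurve.inertia i.1.1).map M.inclX) ⊓ (M.GtpXu l).map M.inclX).map
      ι.toMonoidHom : Subgroup W.Corhat)).topologicalClosure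
  let CuHat : CuspidalInertiaData W :=
    { IsCuspidalInertia := fun Q' J => J ≤ Q' ∧ ∃ i, ∃ γ ∈ W.pmHat, J = MulAut.conj γ • fam i
      le_of_isCuspidalInertia := fun h => h.1 }
  refine ⟨CuHat, fun Q' J => Iff.rfl, ?_⟩
  rintro g' J ⟨-, i, γ, hγ, rfl⟩
  -- `g' = ι(c) · π` with `π ∈ Π̂^±_v`
  have hg' : g' ∈ W.cor ⊔ W.pmHat := by
    rw [cor_sup_pmHat_eq_top e C μ hC hS hl hp2 hpl hζ hη ι hι hinj Φ hΦ hΦK hZ hN T]; trivial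
  rw [← SetLike.mem_coe, Subgroup.mul_normal] at hg'
  obtain ⟨c', hc', π, hπ, rfl⟩ := Set.mem_mul.mp hg'
  obtain ⟨c, hc⟩ := (SetLike.mem_coe.mp hc' : c' ∈ W.cor)
  replace hπ : π ∈ W.pmHat := SetLike.mem_coe.mp hπ
  -- the closed subgroup `cl I(x, c g)` and its conjugator `c' π γ c'⁻¹ ∈ Π̂^±_v`
  have hcl_le : ∀ i, fam i ≤ W.pmHat := by
    intro i
    change (fam i) ≤ (((((M.GtpXu l).map M.inclX).map ι.toMonoidHom : Subgroup W.Corhat))).topologicalClosure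
    exact Subgroup.topologicalClosure_mono (Subgroup.map_mono inf_le_right)
  refine ⟨?_, ⟨i.1, c * i.2⟩, c' * π * γ * c'⁻¹, ?_, ?_⟩
  · -- `⊆ Π̂^±_v`: conjugate of a subgroup of the normal `Π̂^±_v`
    intro y hy
    rw [Subgroup.mem_smul_pointwise_iff_exists] at hy
    obtain ⟨z, hz, rfl⟩ := hy
    rw [Subgroup.mem_smul_pointwise_iff_exists] at hz
    obtain ⟨w, hw, rfl⟩ := hz
    rw [MulAut.smul_def, MulAut.conj_apply, MulAut.smul_def, MulAut.conj_apply]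
    exact W.pmHat_normal.conj_mem _ (W.pmHat_normal.conj_mem _ (hcl_le i hw) γ) _
  · -- the conjugator lies in `Π̂^±_v` (normal in `Π̂^cor_v`)
    have h1 : π * γ ∈ W.pmHat := W.pmHat.mul_mem hπ hγ
    have h2 := W.pmHat_normal.conj_mem _ h1 c'
    rwa [← mul_assoc] at h2
  · -- the computation: `(c' π) γ · cl I(x,g) = (c' π γ c'⁻¹) · (c' · cl I(x,g))` and `c' · cl I(x,g) = cl I(x, c g)` (`c' = ι c`)
    have hfam : MulAut.conj c' • fam i = fam ⟨i.1, c * i.2⟩ := by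
      subst hc
      change MulAut.conj (ι.toMonoidHom c) •
          ((((MulAut.conj i.2 • (M.toTemperedCurve.inertia i.1.1).map M.inclX) ⊓ (M.GtpXu l).map M.inclX).map
            ι.toMonoidHom : Subgroup Q)).topologicalClosure =
        ((((MulAut.conj (c * i.2) • (M.toTemperedCurve.inertia i.1.1).map M.inclX) ⊓ (M.GtpXu l).map M.inclX).map
          ι.toMonoidHom : Subgroup Q)).topologicalClosure
      rw [conj_smul_topologicalClosure, conj_ι_smul_cuspFamily_one e hZ ι.toMonoidHom c i.2]
    rw [← hfam, ← mul_smul, ← map_mul, ← mul_smul, ← map_mul]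
    congr 1
    group

/-- **The tower of record `ofPiCHat`** (inside abc-iut-L2-d3's `Π_C`): the profinite cuspidal datum with law (a), verbatim.
([IUTchII] Def 2.3 (ii)(v), Rmk 2.3.1, kurims pp.68–69) [claim: Mochizuki2012, status: disputed] -/
theorem exists_cuspidalInertiaDataHat_ofPiCHat :
    ∃ CuHat : CuspidalInertiaData (ofPiCHat e C μ hC hS hl hp2 hpl hζ hη hZ hN T),
      (∀ Q' J : Subgroup (ofPiCHat e C μ hC hS hl hp2 hpl hζ hη hZ hN T).Corhat,
        CuHat.IsCuspidalInertia Q' J ↔ J ≤ Q' ∧ ∃ i : {x : M.Pt // M.IsCusp x} × M.GtpC,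
          ∃ γ ∈ (ofPiCHat e C μ hC hS hl hp2 hpl hζ hη hZ hN T).pmHat,
            J = MulAut.conj γ •
              ((((MulAut.conj i.2 • (M.toTemperedCurve.inertia i.1.1).map M.inclX) ⊓ (M.GtpXu l).map M.inclX).map
                e.toPiCHat.toMonoidHom : Subgroup (ofPiCHat e C μ hC hS hl hp2 hpl hζ hη hZ hN T).Corhat)).topologicalClosure) ∧
      (∀ (g' : (ofPiCHat e C μ hC hS hl hp2 hpl hζ hη hZ hN T).Corhat)
          (J : Subgroup (ofPiCHat e C μ hC hS hl hp2 hpl hζ hη hZ hN T).Corhat),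
        CuHat.IsCuspidalInertia (ofPiCHat e C μ hC hS hl hp2 hpl hζ hη hZ hN T).pmHat J →
          CuHat.IsCuspidalInertia (ofPiCHat e C μ hC hS hl hp2 hpl hζ hη hZ hN T).pmHat (MulAut.conj g' • J)) :=
  exists_cuspidalInertiaDataHat_ofCoverModel e C μ hC hS hl hp2 hpl hζ hη e.toPiCHat e.isProfiniteCompletion_toPiCHat
    e.toPiCHat_injective e.piCData.aug.toMonoidHom (fun g => e.piCData_aug_apply g) e.piCData.range_aug hZ hN T

end PlusMinusTower

end Literature.IUT.HodgeArakelov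

end
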